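import Summits.BirchSwinnertonDyer.BirchSwinnertonDyer.Theorems.GenusKolyvaginAtTwoMultiGenusPrimitivityAtTwoAuxiliaryFieldLevelOne

/-!
# Route `GenusKolyvaginAtTwo`, crux stmt-BirchSwinnertonDyer-24947 `MultiGenusPrimitivityAtTwo` (U): AUX-PRIMITIVITY is the
# `2`-primitivity of a ℚ-RATIONAL point of the ODD genus twist `E^{(ℓ*)}` — Kolyvagin's conjecture at `2` in classical form

Lead prover seat bsd-line-gk2-p1 (g6); sequel to p611810 / p613997 / p616107 / p616774. There the crux's certificate at a Kolyvagin
prime `ℓ` was reduced (on `M₀ ≥ 1`, and on row 1 modulo Cor. 3.4 (i) only) to AUX-PRIMITIVITY: «no odd multiple of the reduced genus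
point `W_ℓ` is twice a `ℚ(θ_ℓ)`-RATIONAL point of `E(K[ℓ])`». This file identifies the `ℚ(θ_ℓ)`-rational `χ_ℓ`-isotypic points: with
`u := θ_ℓ` itself (`u² = ℓ* ∈ ℚ`, `u ∉ ℚ`), such a point is a `±`-eigenpoint for the cut-out character of `θ_ℓ` (§1: fixed by the
automorphisms fixing `θ_ℓ`, NEGATED by those negating it — for `σ ∈ Gal(K[ℓ]/K)` by isotypy, for the others through
`σ = g₀·σ_ℓ⁻¹` with `g₀` fixing `θ_ℓ`), hence — twist substitution over `K[ℓ]` + Galois descent, exactly as in `…AuxiliaryFieldTwist` —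
the transport `Φ_θ(ι z)` of a `ℚ`-RATIONAL POINT `z` OF THE ODD GENUS TWIST `W^{(ℓ*)}` (§2, `heegner_thetaRational_isotypic_eq_oddTwistPoint`);
conversely every such transport is `θ_ℓ`-rational and isotypic (§2, naturality). Consequently (§3,
`heegner_auxPrimitive_iff_oddTwistPoint`): with `z₀ ∈ W^{(ℓ*)}(ℚ)` the rational point transporting to an odd multiple `m₀·W_ℓ` (it
exists once the even twist is Sel₂-trivial, p613997/p616107), **AUX-PRIMITIVITY(ℓ) ⟺ no odd multiple of `z₀` is `2`-divisible in
`W^{(ℓ*)}(ℚ)`** — the `2`-PRIMITIVITY OF THE RATIONAL GENUS HEEGNER POINT ON THE RANK-ONE TWIST `E^{(ℓ*)}/ℚ`, whose `2`-Selmer group is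
`ℤ/2` at the primes supplied by gk2-p4's capstone: W. Zhang's «Sel₂ of rank one ⟹ the Heegner class spans it» at `p = 2`, verbatim
shape. Helper (`--supports stmt-BirchSwinnertonDyer-24947`); no named fact; BSD is not proved by any of this.

References: [SilvermanAEC2009] X.2 Prop. 2.4, X.5 Cor. 5.4, I.§1; [Cox2013] §9.A Lemma 9.3; [GrossLMS1991] §3–§5;
[WZhang2014] Thm. 1.1 (the `p ≥ 5` prototype).
-/

set_option linter.dupNamespace false -- tree convention: `Summit.BirchSwinnertonDyer.BirchSwinnertonDyer.Theorems` (summit = sub-problem)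

noncomputable section

open scoped Classical

namespace Summit.BirchSwinnertonDyer.BirchSwinnertonDyer.Theorems.GenusKoly

open Finset NumberField WeierstrassCurve Literature.NumberTheory.EllipticCurves
  Literature.NumberTheory.EllipticCurves.ModularForms
  Summit.BirchSwinnertonDyer.Rank1Residual.AdditivePotMult
  Summit.BirchSwinnertonDyer.Rank1Residual.X11b.RingClassConj

/-! ### §1–§2 `θ_ℓ`-rational isotypic points are rational points of the odd twist `W^{(ℓ*)}` (classical world) -/

section Descent

variable {W : WeierstrassCurve ℚ} {K : Type} [Field K] [NumberField K] {ι : K →+* ℂ}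

/-- **SIGN DICTIONARY for `u = θ_ℓ`.** A `χ_ℓ`-isotypic point fixed by every automorphism fixing `θ_ℓ` is negated by every
automorphism negating `θ_ℓ` (for `σ ∈ Gal(K[ℓ]/K)` by isotypy; otherwise `σ = (σ g)·g⁻¹` with `g ∈ Gal(K[ℓ]/K)` negating `θ_ℓ`,
`σ g` fixing it). [cite: SilvermanAEC2009, X.2 Prop. 2.4 (proof)] [cite: Cox2013, §9.A Lemma 9.3] -/
theorem heegner_thetaRational_isotypic_sign_dictionary {ℓ : ℕ} [DecidableEq (ringClassField K ι ℓ)]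
    (hℓ : ℓ.Prime) {θ : ℕ → ringClassField K ι ℓ}
    (hθ : ∀ ℓ' ∈ ℓ.primeFactors, θ ℓ' ^ 2 = algebraMap ℚ (ringClassField K ι ℓ) ((-1 : ℚ) ^ (ℓ' / 2) * ℓ'))
    (hflip : ∃ g ∈ ringClassGal ι ℓ, g (θ ℓ) = -θ ℓ)
    {S : (W.baseChange (ringClassField K ι ℓ)).toAffine.Point}
    (hS : ∀ h ∈ ringClassGal ι ℓ, pointGalHom W (ringClassField K ι ℓ) h S =
      (∏ ℓ' ∈ ℓ.primeFactors, (if h (θ ℓ') = θ ℓ' then (1 : ℤ) else -1)) • S)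
    (hSrat : ∀ g : ringClassField K ι ℓ ≃ₐ[ℚ] ringClassField K ι ℓ, g (θ ℓ) = θ ℓ →
      pointGalHom W (ringClassField K ι ℓ) g S = S)
    (σ : ringClassField K ι ℓ ≃ₐ[ℚ] ringClassField K ι ℓ) :
    (σ (θ ℓ) = θ ℓ → pointGalHom W (ringClassField K ι ℓ) σ S = S) ∧
      (σ (θ ℓ) ≠ θ ℓ → pointGalHom W (ringClassField K ι ℓ) σ S = -S) := by
  have hPF : ℓ.primeFactors = {ℓ} := Nat.Prime.primeFactors hℓ
  have hℓmem : ℓ ∈ ℓ.primeFactors := by rw [hPF]; exact Finset.mem_singleton_self ℓ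
  have hθ0 : θ ℓ ≠ 0 := ne_zero_of_sq_eq_pStar hℓ (hθ ℓ hℓmem)
  refine ⟨hSrat σ, fun hne ↦ ?_⟩
  have hσθ : σ (θ ℓ) = -θ ℓ := (algEquiv_apply_eq_or_eq_neg_of_sq_eq (hθ ℓ hℓmem) σ).resolve_left hne
  obtain ⟨g, hg, hgθ⟩ := hflip
  -- `g₀ := σ g` fixes `θ`, and `σ = g₀ g⁻¹`
  have hg₀ : (σ * g) (θ ℓ) = θ ℓ := by rw [AlgEquiv.mul_apply, hgθ, map_neg, hσθ, neg_neg]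
  have hgS : pointGalHom W (ringClassField K ι ℓ) g S = -S := by
    have h := hS g hg
    rw [hPF, Finset.prod_singleton, if_neg (by rw [hgθ]; exact fun h' ↦ ne_neg_of_ne_zero hθ0 h'.symm), neg_one_smul] at h
    exact h
  have hginvS : pointGalHom W (ringClassField K ι ℓ) g⁻¹ S = -S := by
    have h : pointGalHom W (ringClassField K ι ℓ) g⁻¹ (pointGalHom W (ringClassField K ι ℓ) g S) = S := by
      rw [← pointGalHom_mul_apply', inv_mul_cancel, map_one]; rfl
    rw [hgS, map_neg] at h
    exact neg_eq_iff_eq_neg.mp h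
  calc pointGalHom W (ringClassField K ι ℓ) σ S
      = pointGalHom W (ringClassField K ι ℓ) ((σ * g) * g⁻¹) S := by rw [mul_inv_cancel_right]
    _ = -S := by rw [pointGalHom_mul_apply', hginvS, map_neg, hSrat _ hg₀]
where
  /-- local generic composition rule -/
  pointGalHom_mul_apply' (a b : ringClassField K ι ℓ ≃ₐ[ℚ] ringClassField K ι ℓ)
      (P : (W.baseChange (ringClassField K ι ℓ)).toAffine.Point) :
      pointGalHom W (ringClassField K ι ℓ) (a * b) P =
        pointGalHom W (ringClassField K ι ℓ) a (pointGalHom W (ringClassField K ι ℓ) b P) := by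
    rw [map_mul]; rfl

/-- **A `θ_ℓ`-RATIONAL `χ_ℓ`-ISOTYPIC POINT IS A RATIONAL POINT OF THE ODD TWIST `W^{(ℓ*)}`**: `S = Φ_θ(ι z)` with
`z ∈ W^{(ℓ*)}(ℚ)`, `Φ_θ` the twist substitution over `K[ℓ]` for `u = θ_ℓ` (`u² = ℓ*`, `u ∉ ℚ`), `ι` the inclusion of `ℚ`-points.
[cite: SilvermanAEC2009, X.2 Prop. 2.4, X.5 Cor. 5.4, I.§1] [cite: Cox2013, §9.A Lemma 9.3] -/
theorem heegner_thetaRational_isotypic_eq_oddTwistPoint {ℓ : ℕ} [hdec : DecidableEq (ringClassField K ι ℓ)]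
    (hK : IsImaginaryQuadratic K) (hℓ : ℓ.Prime) {θ : ℕ → ringClassField K ι ℓ}
    (hθ : ∀ ℓ' ∈ ℓ.primeFactors, θ ℓ' ^ 2 = algebraMap ℚ (ringClassField K ι ℓ) ((-1 : ℚ) ^ (ℓ' / 2) * ℓ'))
    (hθQ : θ ℓ ∉ Set.range (algebraMap ℚ (ringClassField K ι ℓ)))
    (hθℓ : θ ℓ ^ 2 = algebraMap ℚ (ringClassField K ι ℓ) ((-1 : ℚ) ^ (ℓ / 2) * ℓ))
    (hflip : ∃ g ∈ ringClassGal ι ℓ, g (θ ℓ) = -θ ℓ)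
    {S : (W.baseChange (ringClassField K ι ℓ)).toAffine.Point}
    (hS : ∀ h ∈ ringClassGal ι ℓ, pointGalHom W (ringClassField K ι ℓ) h S =
      (∏ ℓ' ∈ ℓ.primeFactors, (if h (θ ℓ') = θ ℓ' then (1 : ℤ) else -1)) • S)
    (hSrat : ∀ g : ringClassField K ι ℓ ≃ₐ[ℚ] ringClassField K ι ℓ, g (θ ℓ) = θ ℓ →
      pointGalHom W (ringClassField K ι ℓ) g S = S) :
    ∃ z : (W.quadraticTwist ((-1 : ℚ) ^ (ℓ / 2) * ℓ)).toAffine.Point,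
      twistPointEquivOver W hθQ hθℓ
        (QuadraticDescent.incl (ringClassField K ι ℓ : Type) (W.quadraticTwist ((-1 : ℚ) ^ (ℓ / 2) * ℓ)) z) = S := by
  have hworld : hdec = fun a b ↦ Classical.propDecidable (a = b) := Subsingleton.elim _ _
  subst hworld
  letI hcl : DecidableEq (ringClassField K ι ℓ) := fun a b ↦ Classical.propDecidable (a = b)
  haveI := (finiteDimensional_and_isGalois_ringClassField hK ι hℓ.ne_zero).1
  haveI : FiniteDimensional ℚ (ringClassField K ι ℓ) := Module.Finite.trans K _
  haveI : IsGalois ℚ (ringClassField K ι ℓ) := isGalois_rat_ringClassField hK ι hℓ.ne_zero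
  have hdict := heegner_thetaRational_isotypic_sign_dictionary hℓ hθ hflip hS hSrat
  have hΦR : twistPointEquivOver W hθQ hθℓ ((twistPointEquivOver W hθQ hθℓ).symm S) = S :=
    (twistPointEquivOver W hθQ hθℓ).apply_symm_apply S
  have hfix : ∀ σ : ringClassField K ι ℓ ≃ₐ[ℚ] ringClassField K ι ℓ,
      Affine.Point.map (W' := W.quadraticTwist ((-1 : ℚ) ^ (ℓ / 2) * ℓ))
          (σ : ringClassField K ι ℓ →ₐ[ℚ] ringClassField K ι ℓ) ((twistPointEquivOver W hθQ hθℓ).symm S) =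
        (twistPointEquivOver W hθQ hθℓ).symm S := by
    intro σ
    by_cases h : σ (θ ℓ) = θ ℓ
    · have hSσ := (hdict σ).1 h
      rw [pointGalHom_apply, ← hΦR, map_twistPointEquivOver W hθQ hθℓ hθQ hθℓ
        (σ : ringClassField K ι ℓ →ₐ[ℚ] ringClassField K ι ℓ) h _] at hSσ
      exact (twistPointEquivOver W hθQ hθℓ).injective hSσ
    · have h' : σ (θ ℓ) = -θ ℓ :=
        (algEquiv_apply_eq_or_eq_neg_of_sq_eq hθℓ σ).resolve_left h
      have hSσ := (hdict σ).2 h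
      rw [pointGalHom_apply, ← hΦR, map_twistPointEquivOver_of_neg W hθQ hθℓ hθQ hθℓ
        (σ : ringClassField K ι ℓ →ₐ[ℚ] ringClassField K ι ℓ) h' _, neg_inj] at hSσ
      exact (twistPointEquivOver W hθQ hθℓ).injective hSσ
  obtain ⟨z, hz⟩ := exists_map_eq_of_forall_map_galois_eq (W.quadraticTwist ((-1 : ℚ) ^ (ℓ / 2) * ℓ))
    (k := ℚ) (L := (ringClassField K ι ℓ : Type)) hfix
  refine ⟨z, ?_⟩
  have hom : Algebra.ofId ℚ (ringClassField K ι ℓ) = (algebraMap ℚ (ringClassField K ι ℓ)).toRatAlgHom :=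
    AlgHom.ext fun q ↦ by simp
  have hincl : QuadraticDescent.incl (ringClassField K ι ℓ : Type) (W.quadraticTwist ((-1 : ℚ) ^ (ℓ / 2) * ℓ)) z =
      Affine.Point.map (W' := W.quadraticTwist ((-1 : ℚ) ^ (ℓ / 2) * ℓ))
        (algebraMap ℚ (ringClassField K ι ℓ)).toRatAlgHom z :=
    congrArg (fun f : ℚ →ₐ[ℚ] ringClassField K ι ℓ ↦
      Affine.Point.map (W' := W.quadraticTwist ((-1 : ℚ) ^ (ℓ / 2) * ℓ)) f z) hom
  rw [hincl.trans hz, hΦR]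

/-- **Conversely, transports of rational points of the odd twist are `θ_ℓ`-rational** (naturality of `Φ_θ` along automorphisms fixing
`θ_ℓ`; `ι z` has rational coordinates). [cite: SilvermanAEC2009, X.2 Prop. 2.4, X.5 Cor. 5.4] -/
theorem heegner_pointGalHom_oddTwistPoint_of_apply_theta_eq {ℓ : ℕ} [hdec : DecidableEq (ringClassField K ι ℓ)]
    {θ : ℕ → ringClassField K ι ℓ}
    (hθQ : θ ℓ ∉ Set.range (algebraMap ℚ (ringClassField K ι ℓ)))
    (hθℓ : θ ℓ ^ 2 = algebraMap ℚ (ringClassField K ι ℓ) ((-1 : ℚ) ^ (ℓ / 2) * ℓ))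
    (z : (W.quadraticTwist ((-1 : ℚ) ^ (ℓ / 2) * ℓ)).toAffine.Point)
    {g : ringClassField K ι ℓ ≃ₐ[ℚ] ringClassField K ι ℓ} (hg : g (θ ℓ) = θ ℓ) :
    pointGalHom W (ringClassField K ι ℓ) g (twistPointEquivOver W hθQ hθℓ
        (QuadraticDescent.incl (ringClassField K ι ℓ : Type) (W.quadraticTwist ((-1 : ℚ) ^ (ℓ / 2) * ℓ)) z)) =
      twistPointEquivOver W hθQ hθℓ
        (QuadraticDescent.incl (ringClassField K ι ℓ : Type) (W.quadraticTwist ((-1 : ℚ) ^ (ℓ / 2) * ℓ)) z) := by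
  have hworld : hdec = fun a b ↦ Classical.propDecidable (a = b) := Subsingleton.elim _ _
  subst hworld
  letI hcl : DecidableEq (ringClassField K ι ℓ) := fun a b ↦ Classical.propDecidable (a = b)
  rw [pointGalHom_apply, map_twistPointEquivOver W hθQ hθℓ hθQ hθℓ
    (g : ringClassField K ι ℓ →ₐ[ℚ] ringClassField K ι ℓ) hg _]
  congr 1
  -- `ι z` has rational coordinates, hence is fixed by `g` (Mathlib `Point.map_baseChange`)
  exact Affine.Point.map_baseChange (W' := W.quadraticTwist ((-1 : ℚ) ^ (ℓ / 2) * ℓ)) (F := ℚ)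
    (K := (ringClassField K ι ℓ : Type)) (g : ringClassField K ι ℓ →ₐ[ℚ] ringClassField K ι ℓ) z

/-- **Multiples transported**: `Φ_θ(ι (k • z)) = k • Φ_θ(ι z)` (both maps are additive). [folklore] -/
theorem heegner_oddTwistTransport_zsmul {ℓ : ℕ} [hdec : DecidableEq (ringClassField K ι ℓ)] [hdecQ : DecidableEq ℚ]
    {θ : ℕ → ringClassField K ι ℓ}
    (hθQ : θ ℓ ∉ Set.range (algebraMap ℚ (ringClassField K ι ℓ)))
    (hθℓ : θ ℓ ^ 2 = algebraMap ℚ (ringClassField K ι ℓ) ((-1 : ℚ) ^ (ℓ / 2) * ℓ))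
    (k : ℤ) (z : (W.quadraticTwist ((-1 : ℚ) ^ (ℓ / 2) * ℓ)).toAffine.Point) :
    twistPointEquivOver W hθQ hθℓ
        (QuadraticDescent.incl (ringClassField K ι ℓ : Type) (W.quadraticTwist ((-1 : ℚ) ^ (ℓ / 2) * ℓ)) (k • z)) =
      k • twistPointEquivOver W hθQ hθℓ
        (QuadraticDescent.incl (ringClassField K ι ℓ : Type) (W.quadraticTwist ((-1 : ℚ) ^ (ℓ / 2) * ℓ)) z) := by
  have hworld : hdec = fun a b ↦ Classical.propDecidable (a = b) := Subsingleton.elim _ _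
  subst hworld
  letI hcl : DecidableEq (ringClassField K ι ℓ) := fun a b ↦ Classical.propDecidable (a = b)
  have hworldQ : hdecQ = fun a b ↦ Classical.propDecidable (a = b) := Subsingleton.elim _ _
  subst hworldQ
  letI hclQ : DecidableEq ℚ := fun a b ↦ Classical.propDecidable (a = b)
  rw [map_zsmul, map_zsmul]

/-- **Injectivity of the transport** `z ↦ Φ (ι z)` from `W^{(ℓ*)}(ℚ)` to `W(K[ℓ])` (both `Φ` and
`ι` are injective). [folklore] -/
theorem heegner_oddTwistTransport_injective {ℓ : ℕ} [hdec : DecidableEq (ringClassField K ι ℓ)]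
    {θ : ℕ → ringClassField K ι ℓ}
    (hθQ : θ ℓ ∉ Set.range (algebraMap ℚ (ringClassField K ι ℓ)))
    (hθℓ : θ ℓ ^ 2 = algebraMap ℚ (ringClassField K ι ℓ) ((-1 : ℚ) ^ (ℓ / 2) * ℓ)) :
    Function.Injective (fun z : (W.quadraticTwist ((-1 : ℚ) ^ (ℓ / 2) * ℓ)).toAffine.Point ↦
      twistPointEquivOver W hθQ hθℓ
        (QuadraticDescent.incl (ringClassField K ι ℓ : Type) (W.quadraticTwist ((-1 : ℚ) ^ (ℓ / 2) * ℓ)) z)) := by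
  have hworld : hdec = fun a b ↦ Classical.propDecidable (a = b) := Subsingleton.elim _ _
  subst hworld
  letI hcl : DecidableEq (ringClassField K ι ℓ) := fun a b ↦ Classical.propDecidable (a = b)
  exact (twistPointEquivOver W hθQ hθℓ).injective.comp
    (QuadraticDescent.incl_injective (K := (ringClassField K ι ℓ : Type)) (W.quadraticTwist ((-1 : ℚ) ^ (ℓ / 2) * ℓ)))

end Descent

/-! ### §3 AUX-PRIMITIVITY ⟺ `2`-primitivity of the rational genus point on the odd twist -/

section OddTwist

variable {W : WeierstrassCurve ℚ} [NeZero (W.conductorNorm ℤ)] {K : Type} [Field K] [NumberField K]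
  {Dt : ModularParametrizationData W (W.conductorNorm ℤ)} {β : ℤ} {ι : K →+* ℂ}

/-- **AUX-PRIMITIVITY IN CLASSICAL FORM.** Crux frame at a Kolyvagin prime `ℓ` at `2`, datum `d`, radicals, `G`, a reduced genus point
`W_ℓ` (`2·W_ℓ = Y_ℓ`), and the even genus twist `W^{(ℓ*·d)}` with finitely many `ℚ`-points (`√d ∈ K ∖ ℚ`). Then there are an odd `m₀`
and a `ℚ`-RATIONAL POINT `z₀` OF THE ODD TWIST `W^{(ℓ*)}` transporting to `m₀·W_ℓ`, and for every such pair: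
**«no odd multiple of `W_ℓ` is twice a `ℚ(θ_ℓ)`-rational point» ⟺ «no odd multiple of `z₀` is `2`-divisible in `W^{(ℓ*)}(ℚ)»**.
(With `#Sel₂(W^{(ℓ*)}) = 2` — gk2-p4's capstone at the supplied primes — the right side says that the Kummer class of the rational
genus point spans `Sel₂(E^{(ℓ*)}/ℚ) ≅ ℤ/2`.) [cite: GrossLMS1991, §3 (3.5), §4 (4.1), Lemma 4.3, §5] [cite: Cox2013, §9.A Lemma 9.3]
[cite: SilvermanAEC2009, X.2 Prop. 2.4, X.5 Cor. 5.4] [cite: WZhang2014, Thm. 1.1 (the p ≥ 5 prototype)] -/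
theorem heegner_auxPrimitive_iff_oddTwistPoint [W.IsElliptic] [W.IsGloballyMinimal]
    (hK : IsImaginaryQuadratic K) (hodd : Odd (NumberField.discr K))
    (hH : SatisfiesHeegnerHypothesis (W.conductorNorm ℤ) K) (hsurj : W.HasSurjectiveModNGaloisRep ((2 : ℤ) ^ 1))
    {ℓ : ℕ} (hℓ : ℓ.Prime) (hKoly : ∀ ℓ' ∈ ℓ.primeFactors, Zhang2014.IsKolyvaginPrime (W.conductorNorm ℤ) W K 2 ℓ')
    (d : KolyvaginHeegnerData Dt β ι ℓ) {θ : ℕ → ringClassField K ι ℓ}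
    (hθ : ∀ ℓ' ∈ ℓ.primeFactors, θ ℓ' ^ 2 = algebraMap ℚ (ringClassField K ι ℓ) ((-1 : ℚ) ^ (ℓ' / 2) * ℓ'))
    (hθQ : θ ℓ ∉ Set.range (algebraMap ℚ (ringClassField K ι ℓ)))
    (hθℓ : θ ℓ ^ 2 = algebraMap ℚ (ringClassField K ι ℓ) ((-1 : ℚ) ^ (ℓ / 2) * ℓ))
    (G : Finset (ringClassField K ι ℓ ≃ₐ[ℚ] ringClassField K ι ℓ)) (hG : ∀ g, g ∈ G ↔ g ∈ ringClassGal ι ℓ)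
    {s₀ : K} (hs₀ : s₀ ∉ Set.range (algebraMap ℚ K)) {dK : ℚ} (hs₀2 : s₀ ^ 2 = algebraMap ℚ K dK)
    (htw : Finite (W.quadraticTwist (((-1 : ℚ) ^ (ℓ / 2) * ℓ) * dK)).toAffine.Point)
    {Wn : (W.baseChange (ringClassField K ι ℓ)).toAffine.Point}
    (hWn : ((2 : ℤ) ^ ℓ.primeFactors.card) • Wn =
      ∑ g ∈ G, (∏ ℓ' ∈ ℓ.primeFactors, (if g (θ ℓ') = θ ℓ' then (1 : ℤ) else -1)) •
        pointGalHom W (ringClassField K ι ℓ) g d.y) :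
    (∃ (m₀ : ℕ) (z₀ : (W.quadraticTwist ((-1 : ℚ) ^ (ℓ / 2) * ℓ)).toAffine.Point), Odd m₀ ∧
      twistPointEquivOver W hθQ hθℓ
        (QuadraticDescent.incl (ringClassField K ι ℓ : Type) (W.quadraticTwist ((-1 : ℚ) ^ (ℓ / 2) * ℓ)) z₀) = (m₀ : ℤ) • Wn) ∧
    ∀ (m₀ : ℕ) (z₀ : (W.quadraticTwist ((-1 : ℚ) ^ (ℓ / 2) * ℓ)).toAffine.Point), Odd m₀ →
      twistPointEquivOver W hθQ hθℓ
        (QuadraticDescent.incl (ringClassField K ι ℓ : Type) (W.quadraticTwist ((-1 : ℚ) ^ (ℓ / 2) * ℓ)) z₀) = (m₀ : ℤ) • Wn →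
      ((∀ m : ℕ, Odd m → ¬ ∃ Q : (W.baseChange (ringClassField K ι ℓ)).toAffine.Point,
          (∀ g : ringClassField K ι ℓ ≃ₐ[ℚ] ringClassField K ι ℓ, g (θ ℓ) = θ ℓ →
            pointGalHom W (ringClassField K ι ℓ) g Q = Q) ∧ (2 : ℤ) • Q = (m : ℤ) • Wn) ↔
        ∀ m : ℕ, Odd m → ¬ ∃ z : (W.quadraticTwist ((-1 : ℚ) ^ (ℓ / 2) * ℓ)).toAffine.Point,
          (2 : ℤ) • z = (m : ℤ) • z₀) := by
  have hℓmem : ℓ ∈ ℓ.primeFactors := by rw [Nat.Prime.primeFactors hℓ]; exact Finset.mem_singleton_self ℓ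
  have hflip : ∃ g ∈ ringClassGal ι ℓ, g (θ ℓ) = -θ ℓ := by
    obtain ⟨-, hσ, -⟩ := heegner_genusRadicals_table hK (Irreducible.squarefree hℓ) hKoly d hθ ℓ hℓmem
    have hσmem : d.σ ℓ ∈ ringClassGal ι ℓ := by
      have := heegner_sigma_pow_mem hℓ d 1
      rw [pow_one] at this
      exact ringClassGalOver_le_ringClassGal ι ℓ 1 this
    exact ⟨d.σ ℓ, hσmem, hσ⟩
  -- isotypy of `W_ℓ`, of its multiples, and of the roots of its odd multiples
  have hWiso : ∀ h ∈ ringClassGal ι ℓ, pointGalHom W (ringClassField K ι ℓ) h Wn =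
      (∏ ℓ' ∈ ℓ.primeFactors, (if h (θ ℓ') = θ ℓ' then (1 : ℤ) else -1)) • Wn := fun h hh ↦
    heegner_genusComponent_root_isotypic hK hodd hH hsurj hℓ.ne_zero d hθ G hG (Finset.mem_powerset_self _) hWn hh
  have hmulIso : ∀ (k : ℤ) {P : (W.baseChange (ringClassField K ι ℓ)).toAffine.Point},
      (∀ h ∈ ringClassGal ι ℓ, pointGalHom W (ringClassField K ι ℓ) h P =
        (∏ ℓ' ∈ ℓ.primeFactors, (if h (θ ℓ') = θ ℓ' then (1 : ℤ) else -1)) • P) →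
      ∀ h ∈ ringClassGal ι ℓ, pointGalHom W (ringClassField K ι ℓ) h (k • P) =
        (∏ ℓ' ∈ ℓ.primeFactors, (if h (θ ℓ') = θ ℓ' then (1 : ℤ) else -1)) • (k • P) := fun k P hP h hh ↦ by
    rw [map_zsmul, hP h hh, smul_comm]
  have hrootIso : ∀ {m : ℕ}, Odd m → ∀ {Q : (W.baseChange (ringClassField K ι ℓ)).toAffine.Point},
      (2 : ℤ) • Q = (m : ℤ) • Wn →
      ∀ h ∈ ringClassGal ι ℓ, pointGalHom W (ringClassField K ι ℓ) h Q =
        (∏ ℓ' ∈ ℓ.primeFactors, (if h (θ ℓ') = θ ℓ' then (1 : ℤ) else -1)) • Q := by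
    rintro m ⟨k, hk⟩ Q hQ h hh
    -- `Q = (Q - k•W) + k•W` with `2 (Q - k•W) = W`
    have h2 : (2 : ℤ) • (Q - (k : ℤ) • Wn) = Wn := by
      have h2' : (2 : ℤ) • Q = (2 * (k : ℤ) + 1) • Wn := by rw [hQ, hk]; norm_cast
      calc (2 : ℤ) • (Q - (k : ℤ) • Wn) = (2 : ℤ) • Q - (2 * (k : ℤ)) • Wn := by rw [smul_sub, smul_smul]
        _ = (2 * (k : ℤ) + 1) • Wn - (2 * (k : ℤ)) • Wn := by rw [h2']
        _ = Wn := by rw [← sub_smul, add_sub_cancel_left, one_smul]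
    have hQ' := heegner_reducedGenusPoint_half_isotypic hK hodd hH hsurj hℓ.ne_zero d hθ G hG hWn h2 hh
    have hdec : Q = (Q - (k : ℤ) • Wn) + (k : ℤ) • Wn := by abel
    rw [hdec, map_add, hQ', hmulIso (k : ℤ) hWiso h hh, smul_add]
  -- injectivity of the transport
  have hinj := heegner_oddTwistTransport_injective (W := W) (K := K) (ι := ι) hθQ hθℓ
  refine ⟨?_, fun m₀ z₀ hm₀ hz₀ ↦ ⟨fun haux m hm ⟨z, hz⟩ ↦ ?_, fun hno m hm ⟨Q, hQrat, hQ⟩ ↦ ?_⟩⟩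
  · -- existence of `(m₀, z₀)`: an odd multiple of `W_ℓ` is `θ_ℓ`-rational (even twist finite ⟹ hR0), then descend
    obtain ⟨τ, hτ, hτθ⟩ := heegner_exists_not_mem_ringClassGal_apply_theta_eq_neg hK hℓ hKoly d hθ
    have hR0 := heegner_conjFixed_isotypic_isOfFinAddOrder_of_twist hK hℓ hθ hs₀ hs₀2
      (heegner_theta_mul_sqrt_not_mem_range hK hℓ hKoly d hθ hs₀) htw hτ hτθ
    obtain ⟨m₀, hm₀, -, hrat⟩ := heegner_isotypic_exists_odd_smul_mem_auxField hK hodd hH hsurj hℓ hθ hτ hτθ hR0 hWiso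
    obtain ⟨z₀, hz₀⟩ := heegner_thetaRational_isotypic_eq_oddTwistPoint hK hℓ hθ hθQ hθℓ hflip
      (hmulIso (m₀ : ℤ) hWiso) hrat
    exact ⟨m₀, z₀, hm₀, hz₀⟩
  · -- `2z = m z₀` ⟹ `Φ(ι z)` is `θ`-rational with `2Φ(ι z) = (m m₀) W`
    refine haux (m * m₀) (hm.mul hm₀) ⟨_, fun g hg ↦
      heegner_pointGalHom_oddTwistPoint_of_apply_theta_eq hθQ hθℓ z hg, ?_⟩
    have h := congrArg (fun z' : (W.quadraticTwist ((-1 : ℚ) ^ (ℓ / 2) * ℓ)).toAffine.Point ↦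
      twistPointEquivOver W hθQ hθℓ
        (QuadraticDescent.incl (ringClassField K ι ℓ : Type) (W.quadraticTwist ((-1 : ℚ) ^ (ℓ / 2) * ℓ)) z')) hz
    rw [heegner_oddTwistTransport_zsmul, heegner_oddTwistTransport_zsmul, hz₀, smul_smul] at h
    rw [h]
    norm_cast
  · -- `2Q = m W` with `Q` `θ`-rational ⟹ `m₀ Q = Φ(ι z)` and `2z = m z₀`
    have hQiso := hrootIso hm hQ
    obtain ⟨z, hz⟩ := heegner_thetaRational_isotypic_eq_oddTwistPoint hK hℓ hθ hθQ hθℓ hflip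
      (hmulIso (m₀ : ℤ) hQiso) (fun g hg ↦ by rw [map_zsmul, hQrat g hg])
    refine hno m hm ⟨z, hinj ?_⟩
    beta_reduce
    rw [heegner_oddTwistTransport_zsmul, heegner_oddTwistTransport_zsmul, hz, hz₀, smul_comm (2 : ℤ) (m₀ : ℤ) Q, hQ,
      smul_comm]

end OddTwist

end Summit.BirchSwinnertonDyer.BirchSwinnertonDyer.Theorems.GenusKoly

end
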